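import Literature.Computability.AlgebraicComplexity.CircuitArithmetization
import Literature.Computability.AlgebraicComplexity.HamiltonianCycleVNP
import Literature.Computability.AlgebraicComplexity.KRSTSelection
import Literature.Barriers.ValiantsHypothesis.AlgebraicNaturalProofs
import Literature.Barriers.ValiantsHypothesis.GKSS17FSVPresentation
import HarnessLib

/-!
# ValiantsHypothesis / BarrierLever — FSV's SLICE-RELATIVE technique class is COMPLETE (kernel):
# a `{-1,0,1}`-relative natural proof against a sign-slice family exists iff the family escapes `VP`

Decomposition workshop `decomp-valiant`, lens 2 (natural-proofs / succinctness axis), generation 12,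
lens certificate of node «ArithmeticDescent».  Bears on route `BarrierLever`'s crux
`SuccinctHittingSetsForVP` (stmt-ValiantsHypothesis-14610, FSV Question 6) through its relative
form `SuccinctHittingSetsForVPRel … (signCoeffSlice …)` and on the tree's
`CKRST2020.exists_naturalProofAgainstVPRel_signCoeffSlice` (CKRST 2020 Thm. 1.6: relative natural
proofs exist for an INEXPLICIT `{-1,0,1}` target).

`naturalProofAgainstVPRel_signCoeffSlice_iff`: over any field with `2 ≠ 0`, for EVERY target family
`h` with `{-1,0,1}` coefficients and `deg h_n ≤ n` (e.g. `per`, `det`, `HC`),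

  `NaturalProofAgainstVPRel F (signCoeffSlice F) 4 h  ↔  ∀ b n₀, ∃ n ≥ n₀, h n ∉ SmallCircuits F n b`.

Soundness (`→`) is the tree's `exists_not_mem_smallCircuits_of_rel`; completeness (`←`) is the
three-point Lagrange POINT INDICATOR of `h_n`'s own coefficient vector: the product over the
`N = binom(2n,n)` coordinates of `c(c+1)`, `c(c-1)` or `1 - c²` according to the target coefficient
`1`, `-1`, `0` has size `≤ 4N ≤ N⁴`, degree `≤ 2N`, vanishes at every OTHER point of `{-1,0,1}^N`
(in particular at every simple member of the slice once `h_n` is not simple) and takes the value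
`2^k ≠ 0` at `h_n`.  Consequently "there is a slice-relative algebraically natural proof against
`per`" is `per ∉ VP` (regime `d = n`) REWORDED — a decomposition node of the shape
"`P(per)` ∧ (`P` fails on `VP ∩ slice`)" over slice-natural `P` is a costume — and the content of
CKRST's Theorem 1.6 is the UNIFORMITY of its equations (one family for all `b`, vanishing on the
whole simple part of the slice, independent of the target), not their existence.
References: [ForbesShpilkaVolk2018] M. Forbes, A. Shpilka, B. L. Volk, Succinct hitting sets and
barriers to proving lower bounds for algebraic circuits, Theory of Computing 14 (2018), Def. 1 /
Question 6; [ChatterjeeKumarRamyaSaptharishiTengse2020] P. Chatterjee, M. Kumar, C. Ramya,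
R. Saptharishi, A. Tengse, On the existence of algebraically natural proofs, FOCS 2020 /
arXiv:2004.14147, Thm. 1.6.

HONEST FRAMING: an elementary observation (Lagrange interpolation on `{-1,0,1}^N`), recorded because
the workshop's lens needed it as a kernel fact; no lower bound is proved.  Sorry-free.
-/

noncomputable section
set_option linter.dupNamespace false

open MvPolynomial
open Literature.Computability.AlgebraicComplexity

namespace Summit.ValiantsHypothesis.ValiantsHypothesis.Theorems.SliceNaturalProofsComplete

open Literature.Barriers.ValiantsHypothesis

variable {F : Type*} [Field F] [DecidableEq F]

/-- The three-point Lagrange factor at one coordinate: vanishes at the two values of `{-1,0,1}`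
other than `t`, takes the value `1` or `2` at `t`. [folklore] -/
def signFactor {M : Type*} (t : F) (m : M) : MvPolynomial M F :=
  if t = 1 then X m * (X m + C 1) else if t = -1 then X m * (X m + C (-1)) else 1 - X m * X m

/-- Each factor costs at most `3` gates. [folklore] -/
theorem complexity_signFactor_le {M : Type*} (t : F) (m : M) :
    complexity (signFactor t m) ≤ 3 := by
  unfold signFactor
  have hX : complexity (X m : MvPolynomial M F) = 0 := complexity_X_holds m
  have hC : ∀ a : F, complexity (C a : MvPolynomial M F) = 0 := fun a => complexity_C_holds a
  have hXa : ∀ a : F, complexity (X m + C a : MvPolynomial M F) ≤ 1 := fun a => by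
    have h1 := complexity_add_le_holds (X m : MvPolynomial M F) (C a)
    rw [hX, hC] at h1
    omega
  have hmul : ∀ a : F, complexity (X m * (X m + C a) : MvPolynomial M F) ≤ 3 := fun a => by
    have h1 := complexity_mul_le_holds (X m : MvPolynomial M F) (X m + C a)
    have h2 := hXa a
    rw [hX] at h1
    omega
  have hsq : complexity (1 - X m * X m : MvPolynomial M F) ≤ 3 := by
    have h1 := complexity_mul_le_holds (X m : MvPolynomial M F) (X m)
    have h2 := CircuitArith.complexity_one_sub_le (X m * X m : MvPolynomial M F)
    rw [hX] at h1
    omega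
  split_ifs
  · exact hmul _
  · exact hmul _
  · exact hsq

/-- Each factor has degree at most `2`. [folklore] -/
theorem totalDegree_signFactor_le {M : Type*} (t : F) (m : M) :
    (signFactor t m).totalDegree ≤ 2 := by
  unfold signFactor
  have hX : (X m : MvPolynomial M F).totalDegree = 1 := totalDegree_X m
  have hXa : ∀ a : F, (X m + C a : MvPolynomial M F).totalDegree ≤ 1 := fun a =>
    (totalDegree_add _ _).trans (by rw [hX, totalDegree_C]; simp)
  have hmul : ∀ a : F, (X m * (X m + C a) : MvPolynomial M F).totalDegree ≤ 2 := fun a =>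
    (totalDegree_mul _ _).trans (by have := hXa a; rw [hX]; omega)
  have hsq : (1 - X m * X m : MvPolynomial M F).totalDegree ≤ 2 :=
    (totalDegree_sub _ _).trans (by
      rw [totalDegree_one]
      have h1 := totalDegree_mul (X m : MvPolynomial M F) (X m)
      rw [hX] at h1
      exact max_le (Nat.zero_le _) h1)
  split_ifs
  · exact hmul _
  · exact hmul _
  · exact hsq

/-- Vanishing: at a `{-1,0,1}`-point whose `m`-th coordinate differs from `t`. [folklore] -/
theorem eval_signFactor_eq_zero {M : Type*} {t c : F} (x : M → F) (m : M) (hx : x m = c)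
    (hc : c = 0 ∨ c = 1 ∨ c = -1) (ht : t = 0 ∨ t = 1 ∨ t = -1) (hct : c ≠ t) :
    eval x (signFactor t m) = 0 := by
  unfold signFactor
  split_ifs with h1 h2
  · simp only [map_mul, map_add, eval_X, eval_C, hx]
    rcases hc with rfl | rfl | rfl
    · simp
    · exact absurd h1.symm hct
    · ring
  · simp only [map_mul, map_add, eval_X, eval_C, hx]
    rcases hc with rfl | rfl | rfl
    · simp
    · ring
    · exact absurd h2.symm hct
  · have ht0 : t = 0 := by
      rcases ht with h | h | h
      · exact h
      · exact absurd h h1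
      · exact absurd h h2
    simp only [map_sub, map_one, map_mul, eval_X, hx]
    rcases hc with rfl | rfl | rfl
    · exact absurd ht0.symm hct
    · ring
    · ring

/-- Non-vanishing at the node itself (needs `2 ≠ 0`). [folklore] -/
theorem eval_signFactor_ne_zero {M : Type*} {t : F} (h2 : (2 : F) ≠ 0) (x : M → F) (m : M)
    (hx : x m = t) (ht : t = 0 ∨ t = 1 ∨ t = -1) : eval x (signFactor t m) ≠ 0 := by
  unfold signFactor
  split_ifs with h1 h2'
  · have hv : eval x (X m * (X m + C 1) : MvPolynomial M F) = 2 := by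
      simp only [map_mul, map_add, eval_X, eval_C, hx, h1]; ring
    rw [hv]; exact h2
  · have hv : eval x (X m * (X m + C (-1)) : MvPolynomial M F) = 2 := by
      simp only [map_mul, map_add, eval_X, eval_C, hx, h2']; ring
    rw [hv]; exact h2
  · have ht0 : t = 0 := by
      rcases ht with h | h | h
      · exact h
      · exact absurd h h1
      · exact absurd h h2'
    have hv : eval x (1 - X m * X m : MvPolynomial M F) = 1 := by
      simp only [map_sub, map_one, map_mul, eval_X, hx, ht0]; ring
    rw [hv]; exact one_ne_zero

/-- **Slice completeness of FSV's relative technique class** (`d = n` regime, over any field with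
`2 ≠ 0`): for EVERY target family `h` in the `{-1,0,1}` coefficient slice of degree `≤ n`, a
`signCoeffSlice`-relative natural proof of level `4` against `h` exists if and only if `h` escapes
`SmallCircuits F n b` infinitely often for every `b` — the point indicator of `h_n`'s coefficient
vector (a product of `N = binom(2n,n)` three-point Lagrange factors, size `≤ 4N`, degree `≤ 2N`)
is the distinguisher.  Hence "per has a slice-relative algebraically natural proof" is `per ∉ VP`
reworded: the sandwich cannot be a decomposition node (COSTUME, by this theorem), and the content of
CKRST 2020 Thm. 1.6 is the UNIFORMITY of its equations, not their existence.
[cite: ForbesShpilkaVolk2018, Def. 1] -/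
theorem naturalProofAgainstVPRel_signCoeffSlice_iff (h2 : (2 : F) ≠ 0)
    {h : ∀ n, MvPolynomial (Fin n) F} (hS : ∀ n, h n ∈ signCoeffSlice F n)
    (hdeg : ∀ n, (h n).totalDegree ≤ n) :
    NaturalProofAgainstVPRel F (signCoeffSlice F) 4 h ↔
      ∀ b n₀ : ℕ, ∃ n, n₀ ≤ n ∧ h n ∉ SmallCircuits F n b := by
  classical
  refine ⟨fun hnat b n₀ => exists_not_mem_smallCircuits_of_rel hnat hS b n₀, fun H => ?_⟩
  intro b n₀
  obtain ⟨n, hn, hnot⟩ := H b (max n₀ 1)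
  have hn₀ : n₀ ≤ n := le_trans (le_max_left _ _) hn
  have hn1 : 0 < n := lt_of_lt_of_le (lt_of_lt_of_le zero_lt_one (le_max_right _ _)) hn
  obtain ⟨N, hN⟩ : ∃ N, (2 * n).choose n = N := ⟨_, rfl⟩
  have hcard : (Finset.univ : Finset (degLEMonomials n)).card = N := by
    rw [Finset.card_univ, ← Nat.card_eq_fintype_card, GKSS2017.card_degLEMonomials, hN]
  have hN2 : 2 ≤ N := by
    rw [← hN, ← GKSS2017.card_degLEMonomials]
    exact GKSS2017.two_le_card_degLEMonomials hn1
  have hN4 : 4 ≤ N ^ 3 := le_trans (by norm_num) (Nat.pow_le_pow_left hN2 3)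
  refine ⟨n, hn₀, ∏ m : degLEMonomials n, signFactor (coeff (m : Fin n →₀ ℕ) (h n)) m,
    ⟨?_, ?_⟩, ?_, ?_⟩
  · -- size: `≤ 3N + N = 4N ≤ N^4`
    rw [hN]
    have hle := complexity_prod_le_of_le (Finset.univ : Finset (degLEMonomials n))
      (fun m => signFactor (coeff (m : Fin n →₀ ℕ) (h n)) m) 3
      (fun m _ => complexity_signFactor_le _ _)
    rw [hcard] at hle
    refine hle.trans ?_
    calc N * 3 + N = 4 * N := by ring
      _ ≤ N ^ 3 * N := Nat.mul_le_mul_right _ hN4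
      _ = N ^ 4 := by ring
  · -- degree: `≤ 2N ≤ N^4`
    rw [hN]
    have hle : (∏ m : degLEMonomials n, signFactor (coeff (m : Fin n →₀ ℕ) (h n)) m).totalDegree
        ≤ N * 2 := by
      refine (totalDegree_finsetProd _ _).trans ?_
      refine (Finset.sum_le_sum fun (m : degLEMonomials n) _ => totalDegree_signFactor_le
        (coeff (m : Fin n →₀ ℕ) (h n)) m).trans ?_
      rw [Finset.sum_const, smul_eq_mul, hcard]
    refine hle.trans ?_
    calc N * 2 ≤ N * N ^ 3 := Nat.mul_le_mul_left _ (by omega)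
      _ = N ^ 4 := by ring
  · -- vanishing on the simple members of the slice: they differ from `h n` in some coordinate
    intro f hf hfS
    have hne : f ≠ h n := fun hEq => hnot (hEq ▸ hf)
    obtain ⟨m, hm⟩ : ∃ m, coeff m f ≠ coeff m (h n) :=
      not_forall.1 fun hall => hne (MvPolynomial.ext _ _ hall)
    have hmdeg : m.degree ≤ n := by
      rcases ne_or_eq (coeff m f) 0 with hf0 | hf0
      · have hle := le_totalDegree (mem_support_iff.2 hf0)
        rw [Finsupp.degree_apply]
        exact hle.trans hf.1
      · have hh0 : coeff m (h n) ≠ 0 := by rw [hf0] at hm; exact hm.symm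
        have hle := le_totalDegree (mem_support_iff.2 hh0)
        rw [Finsupp.degree_apply]
        exact hle.trans (hdeg n)
    have hmem : m ∈ degLEMonomials n := hmdeg
    rw [map_prod]
    exact Finset.prod_eq_zero (Finset.mem_univ (⟨m, hmem⟩ : degLEMonomials n))
      (eval_signFactor_eq_zero _ _ (coeffVector_apply _ _ _) (hfS m) (hS n m) hm)
  · -- non-vanishing at the target
    rw [map_prod]
    exact Finset.prod_ne_zero_iff.2 fun m _ =>
      eval_signFactor_ne_zero h2 _ _ (coeffVector_apply _ _ _) (hS n m)

end Summit.ValiantsHypothesis.ValiantsHypothesis.Theorems.SliceNaturalProofsComplete
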